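import Summits.Ventures.YMGap.Thresholds.SharpImprovedThresholdFree
import Summits.Ventures.YMGap.Thresholds.StarMassGapDimRows
import Summits.Ventures.YMGap.Census.ZplusLowerBound
import HarnessLib

/-!
# Venture statement — YMGap (cell `pub-ymgap`) — CONJUNCT BODIES for the v1.4 append of `Statement.lean` (T16, T18, T21)

STATUS (2026-08-23T00:40Z, p3-g3): all three parents are IN THE TREE (`Thresholds/SharpImprovedThresholdFree.lean` =
p1's OBJECT-U capstone; `Thresholds/StarMassGapDimRows.lean` = ds-1 g5's general-dimension rows;
`Census/ZplusLowerBound.lean` = lit-2 g8). Index append to follow in `Statement.lean`: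
`YMGapStatementV1_3 := YMGapStatementV1_2 ∧ T17 ∧ T19 ∧ T20` (bodies in `StatementConjunctsV13`) and
`YMGapStatementV1_4 := YMGapStatementV1_3 ∧ T16 ∧ T18 ∧ T21` (bodies here), in ONE append once this file is built.

HONEST FRAMING. WHAT THIS IS: bodies `Tk_… : Prop` + witnesses of three conjuncts of the venture statement
(index of record: `Summits/Ventures/YMGap/Statement.lean`, append-only). All three are kernel-checked and
carry NO hypothesis; T16/T18 are statements about lattice `SU(N)` Yang–Mills at STRONG COUPLING ('t Hooft scaling):
* **T16** (track (a), the A2 headline): `ImprovedThreshold d N (1/(8d))` for EVERY `d ≥ 3`, EVERY `N ≥ 2`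
  — `1/(16(d−1)) < 1/(8d)` and `MassGapAt d N β` (unique DLR state + exponential clustering) at every
  `|β| < 1/(8d)`; `d = 4`: `1/32` against the printed `1/48`. Static proof: sharp Bakry–Émery Hessian
  `4dN|β|` → uniform kernel covariance decay → boundary-tilt influence → DLR uniqueness + SZZ Cor. 4.11
  transfer (seats p2, lit-1, ds-2, p1). T6 is the same target modulo three printed facts; T16 removes them.
* **T18** (track (c) in every dimension): the star door's rows for every `d ≥ 2` — (i) all `N ≥ 2`:
  `ImprovedThreshold d N (1/(12(d−1)))` (printed `1/(16(d−1))`, `× 4/3` uniformly in `d`); (ii) the `SU(2)`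
  column at the exact door `(√(4d²−8d+5) − (2d−3))/(4(d−1))`; (iii) `d = 3`, all `N ≥ 2`:
  `ImprovedThreshold 3 N (2/45)` (at `d = 3` the star door `2/45` exceeds the sharp `1/24`) (seats ds-4, ds-1).
* **T21** (track (b), UNCONDITIONAL): Tomboulis's Prop. IV.2 (ii) eq. (4.10) with the Appendix-A exponent `L^d/4` —
  `Z⁺_Λ ≥ (1 + Σ (n+1)² c_n⁶)^{L^d/4}` on every even torus, `d ≥ 3`, every `J`, every plane (seat lit-2 g8).
WHAT THIS IS NOT: no continuum statement, no rate beyond `∃ c > 0`, no spectral gap, no Millennium claim.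
-/

noncomputable section

namespace Summit.Ventures.YMGap

open Literature.MathematicalPhysics.QuantumFieldTheory

/-- **T16 — the track-(a) TARGET TYPE at the SHARP Bakry–Émery threshold, EVERY `d ≥ 3`, EVERY `N ≥ 2`,
UNCONDITIONAL**: `ImprovedThreshold d N (1/(8d))` (`SharpUniquenessJoin.improvedThreshold_sharp_free`;
`HessianSharp.sharpThresholdSU d = 1/(8d)` by `rfl`; `d = 4`: `1/32` vs printed `1/48`; compare T6 = the same
modulo three printed facts, T11 = `9/308` at `d = 4` by the star door). -/
def T16_SUNSharpBakryEmeryThreshold : Prop :=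
  ∀ d N : ℕ, 3 ≤ d → 2 ≤ N → ImprovedThreshold d N (1 / (8 * d))

/-- T16 holds (`SharpUniquenessJoin.improvedThreshold_sharp_free`). -/
theorem T16_SUNSharpBakryEmeryThreshold_holds : T16_SUNSharpBakryEmeryThreshold :=
  fun _ _ hd hN => SharpUniquenessJoin.improvedThreshold_sharp_free hd hN

/-- **T18 — the STAR DOOR's rows in EVERY dimension `d ≥ 2`, UNCONDITIONAL** ('t Hooft units):
(i) every `N ≥ 2`: `ImprovedThreshold d N (1/(12(d−1)))` (`StarDimMassGap.improvedThreshold_SU_dim`);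
(ii) `SU(2)` at the exact door: `ImprovedThreshold d 2 ((√(4d²−8d+5) − (2d−3))/(4(d−1)))` (Wilson
`β⋆_G(d) = (√(4d²−8d+5) − (2d−3))/(d−1)`: `0.5616, 0.3609, 0.2656, 0.2100` for `d = 3..6`)
(`StarDimMassGap.su2_improvedThreshold_dim`); (iii) `d = 3`, every `N ≥ 2`: `ImprovedThreshold 3 N (2/45)`
(`StarDimMassGap.improvedThreshold_SU_three`). Texts: seat ds-1 (g5). -/
def T18_SUNStarRowsAllDimensions : Prop :=
  (∀ d N : ℕ, 2 ≤ d → 2 ≤ N → ImprovedThreshold d N (1 / (12 * ((d : ℝ) - 1)))) ∧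
    (∀ d : ℕ, 2 ≤ d →
      ImprovedThreshold d 2 ((Real.sqrt (4 * (d : ℝ) ^ 2 - 8 * d + 5) - (2 * (d : ℝ) - 3)) / (4 * ((d : ℝ) - 1)))) ∧
    (∀ N : ℕ, 2 ≤ N → ImprovedThreshold 3 N (2 / 45))

/-- T18 holds (`StarDimMassGap.improvedThreshold_SU_dim`, `StarDimMassGap.su2_improvedThreshold_dim`,
`StarDimMassGap.improvedThreshold_SU_three`). -/
theorem T18_SUNStarRowsAllDimensions_holds : T18_SUNStarRowsAllDimensions :=
  ⟨fun _ _ hd hN => StarDimMassGap.improvedThreshold_SU_dim hd hN,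
    fun _ hd => StarDimMassGap.su2_improvedThreshold_dim hd,
    fun _ hN => StarDimMassGap.improvedThreshold_SU_three hN⟩

/-- **T21 — track (b): Tomboulis's Prop. IV.2 (ii) eq. (4.10) with the Appendix-A exponent, on EVERY even torus
`(ℤ/Lℤ)^d`, `d ≥ 3`, every spin cut-off `J`, every plane, UNCONDITIONAL**: for admissible coefficients,
`Z⁺_Λ({c_j}) = (Z_Λ + Z⁻_Λ(𝒱_{ij}))/2 ≥ (1 + Σ_{n=1}^{J} (n+1)² c_n⁶)^{L^d/4}` (hence (4.11): `Z⁺ ≥ 1`)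
(`Census.torusZplus_lowerBound_quarter`; seat lit-2; as printed the exponent is `|Λ|`, cf. T8 (i) / T17 (iv)).
Finite-torus statement; nothing about (5.15), the thermodynamic limit or confinement. -/
def T21_TomboulisZplusLowerBound : Prop :=
  ∀ (d L : ℕ) [NeZero d] [NeZero L] [Fact (1 < L)], 3 ≤ d → Even L →
    ∀ (J : ℕ) (i j : Fin d) (hij : i < j) (c : ℕ → ℝ), Tomboulis2007.CoeffAdmissible c →
      (1 + ∑ n ∈ Finset.Icc 1 J, ((n : ℝ) + 1) ^ 2 * c n ^ 6) ^ (L ^ d / 4) ≤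
        Tomboulis2007.torusZplus d L J c (Tomboulis2007.vortexSheet L i j hij)

/-- T21 holds (`Census.torusZplus_lowerBound_quarter`). -/
theorem T21_TomboulisZplusLowerBound_holds : T21_TomboulisZplusLowerBound :=
  fun _ _ _ _ _ hd hL J _ _ hij _ hc => Census.torusZplus_lowerBound_quarter hd hL J hij hc

end Summit.Ventures.YMGap

end
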